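import Summits.HubbardSuperconductivity.HubbardSuperconductivity.Theorems.AnisotropyChordTransferFibre3FinXDCheck

/-!
# Route `AnisotropyChord` / H0 rotor rung: FIN per-`L` row-D (KT-2a″) SUB-CELL facts, `L = 9` (114–119)

Row-D facts `xdCellAny0 9 (49/50) la lb aD = true` on quarter sub-cells of the combined cells whose side condition needs `aD ≈ .04` (mechhunt STATUS p3 g7 REPORT 3).
Prover seat `hubbard-h0-rotor-p3` g7; helper for piece A = stmt-HubbardSuperconductivity-23918 of rung 19089 (`--supports`, helper class).
WHAT THIS IS NOT: nothing here proves superconductivity in the Hubbard model (rotor TARGET as worded stays FALSE, g15 verdict); kernel facts /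
assembly for ONE conditional reduction at one `L`.  No sorry.
-/

set_option linter.dupNamespace false
set_option autoImplicit false

namespace Summit.HubbardSuperconductivity.HubbardSuperconductivity.Theorems.AnisotropyChord.Transfer.Fibre3

namespace FinXD

/-- row-D sub-cell `[21742402196124679, 21876614555360016]` of `L = 9`. [folklore] -/
theorem xd9s_139_2 : xdCellAny0 9 (49/50 : ℚ) 21742402196124679 21876614555360016 (1/25 : ℚ) = true := by decide +kernel

/-- row-D sub-cell `[21876614555360016, 22010826914595353]` of `L = 9`. [folklore] -/
theorem xd9s_139_3 : xdCellAny0 9 (49/50 : ℚ) 21876614555360016 22010826914595353 (1/25 : ℚ) = true := by decide +kernel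

/-- row-D sub-cell `[22010826914595353, 22148394582811573]` of `L = 9`. [folklore] -/
theorem xd9s_140_0 : xdCellAny0 9 (49/50 : ℚ) 22010826914595353 22148394582811573 (1/25 : ℚ) = true := by decide +kernel

/-- row-D sub-cell `[22148394582811573, 22285962251027793]` of `L = 9`. [folklore] -/
theorem xd9s_140_1 : xdCellAny0 9 (49/50 : ℚ) 22148394582811573 22285962251027793 (1/25 : ℚ) = true := by decide +kernel

/-- row-D sub-cell `[22285962251027793, 22423529919244013]` of `L = 9`. [folklore] -/
theorem xd9s_140_2 : xdCellAny0 9 (49/50 : ℚ) 22285962251027793 22423529919244013 (1/25 : ℚ) = true := by decide +kernel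

/-- row-D sub-cell `[22423529919244013, 22561097587460233]` of `L = 9`. [folklore] -/
theorem xd9s_140_3 : xdCellAny0 9 (49/50 : ℚ) 22423529919244013 22561097587460233 (1/25 : ℚ) = true := by decide +kernel

end FinXD

end Summit.HubbardSuperconductivity.HubbardSuperconductivity.Theorems.AnisotropyChord.Transfer.Fibre3
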